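import Literature.MathematicalPhysics.QuantumFieldTheory.Balaban1983to89.B16Sect1Assembly

/-!
# `Balaban1983to89.B16Eq170Assembly` — T. Bałaban, *Large field renormalization. II. Localization, exponentiation, and
bounds for the 𝐑 operation*, Commun. Math. Phys. **122** (1989) 355–392 [Balaban1989LargeFieldII], Sect. 1 p. 377
display **(1.70)** — *"The result of all the preceding operations can be written as the equality: (1.1) = …"*, the
assembly display after the localizations and resummations (1.50)–(1.69) — typed as a real number over the EXPLICIT
Bochner integral of the gen-4 module `…B16Sect1Assembly` ((1.1) `term11`, (1.49) `rhs149`/`bracket149`), and PROVED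
from (1.49) by the bookkeeping pp. 370–378 describe: the `B`-independent part of the inductive terms becomes the new
action `A′_k(1/(g_k(·))², U_k)` in front of the integral, the `Z`-meeting parts and `𝐂_k` become `Σ_Y V(Y, U_k, B)`,
and `−E_k ↦ +E_k(Z)`

statement-level skeleton of published theorems with citation tags; proofs where landed; nothing here is a claim about
the Yang–Mills mass gap

PDF held: `paper:balaban1989-cmp122-large-field-ii` (journal page = PDF page + 354); [IV] = [Balaban1989LargeFieldI],
[III] = [Balaban1988Convergent].  The display and the sentences quoted below were READ AS AN IMAGE by this seat on the x2
render `run/shared/lean/pub/pub-balaban/b2b-balaban-ref1/pages/1989-cmp122-large-field-II/…-p023-x2.png` (p. 377); the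
`E_k(Z)` sentence of p. 378 on the OCR `p0024.txt` ll. 2–3 (clean there).

CITATION HEADER / WHAT IS REPRODUCED (mega-formalization `lit-balaban`, reader/typer r13 gen 7; HOME
`run/shared/lean/pub/lit-balaban/`, rows `lit-balaban-r13/ROWS-B16.md` v2.21): SKELETON row **B16.Eq1.70** (cell
«typed-existing (models); display absent»: the component-supported form and the weight of the new-region operation are
modelled in `…B16ComponentForm` / `…B16Cor3Wilson`; the display itself was not typed).  Audit-cell record
`pub-balaban/GAPS.md` C-B16-4: *"(1.70) vs (1.49): A′_k := −A(g_k⁻², U_k) + Z-disjoint parts of E_k, R_k, B_k, B″_k − their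
share of E_k ✓, Σ_Y V(Y, U_k, B) := C_k + Z-meeting parts + localization remainders ✓, «−E_k» (1.49) ↦ «+E_k(Z)» (1.70) with
E_k(Z) := the normalization/vacuum-energy terms meeting Z (p. 378) — a different object from E_k; naming drift only
(D-b02.5)"* — exactly the hypothesis `hres` below.

WHAT IS PRINTED (p. 377 [PDF 23], verbatim).  *"After the addition of the above described terms we obtain a new action,
which contains all the necessary 𝐄-terms, and all the 𝐑-terms and boundary terms connected with the first k − 1
operations 𝐑T. It contains also some 𝐑-terms and boundary terms connected with the k^{th} renormalization transformation
T, but these will be completed yet. Denote this action by A′_k. The result of all the preceding operations can be written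
as the equality: (1.1) = χ_kχ_{k,Λ}δ_{G₀}(V′_k)χ exp A′_k(1/(g_k(·))², U_k) · χ_{h,1/2}∫dB σ(g_kB)δ_{T₀}(B)χ′
exp[−½⟨DH″_{1,k,Z}B, ζDH″_{1,k,Z}B⟩ − A((1/(g″_k(·))²)ζ₁, U″_{h+2}(exp ig_kB, V″)) + Σ_Y V(Y, U_k, B) + E_k(Z) + (−½d(𝐠) log g_k⁻²
+ log σ₀)|𝐁₀∖T₀| − E_k(Λ)], (1.70)"*; p. 378: *"where E_k(Z) denotes the sum of normalization terms and vacuum energy terms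
with localizations intersecting the large field domain Z."*; p. 377 (the terms `V(Y, U_k)`): *"Thus, after all these
resummations we obtain a sum of expressions, the summation is over domains Y ∈ 𝐃_k satisfying the property that the
intersection Y∩Z˜ is a union of components of Z˜, containing at least one component. The expression corresponding to such
a domain Y depends on the new background field U_k restricted to Y, and also on the fields A, B, V″ localized in Y. We
denote this expression by V(Y, U_k)."*

WHAT IS HERE.  Carriers as in `…B16Sect1Assembly` (ref-1 F6): `μNB` on `ΩNB` = `dB δ_{T₀}(B)`, `wN b = σ(g_kB)χ′`, every
term of the bracket a real FUNCTION of the integration variable `B`, the prefactors real FACTORS.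
* `bracket170` — the bracket of (1.70) (`Q121` = the form ⟨DH″_{1,k,Z}B, ζDH″_{1,k,Z}B⟩, `Ah2` = the ζ₁-Wilson term
  `A((1/(g″_k(·))²)ζ₁, U″_{h+2}(exp ig_kB, V″))`, `SV` = `Σ_Y V(Y, U_k, B)`, `EkZ` = `E_k(Z)`, the constant
  `(−½d(𝐠) log g_k⁻² + log σ₀)|𝐁₀∖T₀|` = `B16Sect1Wilson.Ek110 dg gk σ₀ nBT` as in (1.49), `EkΛ` = `E_k(Λ)`); `rhs170` — the
  right-hand side with `Apk` = the number `A′_k(1/(g_k(·))², U_k)`; **`Eq170`** — the display `(1.1) = rhs170` as a `Prop`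
  over the (1.1) data of `term11`.
* **`rhs149_eq_rhs170`**, **`eq170_of_eq149`** — PROVED: if, pointwise in `B`, the inductive terms of the (1.49) bracket
  regroup as print describes, `𝐂_k + 𝐄_k(U″_k) + 𝐑_k(U″_k) + 𝐁_k(U″_k, A) + 𝐁″_k(U″_k, A) − E_k = [A′_k(1/(g_k(·))², U_k) +
  A(1/(g_k(·))², U_k)] + Σ_Y V(Y, U_k, B) + E_k(Z)` (`hres`; the square bracket is `B`-INDEPENDENT — p. 377: the terms not
  meeting `Z` *"depend on the new background field U_k"* only), then the right-hand side of (1.49) IS the right-hand side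
  of (1.70) (`exp[−A(1/(g_k(·))², U_k)]·exp[… + A′_k + A(…) …] = exp A′_k · exp[…]`, the constant pulled out of the
  integral), and with the gen-4 `eq149` (1.1) = (1.70).
NOT HERE: the localizations (1.50)–(1.66) and resummations (1.67)–(1.69) that PRODUCE the regrouping `hres` (rows
B16.Eq1.50–1.69; audit records C-B16-4, G-B16-04/05), the bounds (1.68)–(1.69) on `V(Y, ·)`, the operation form (1.71).
No `sorry`, no axiom; nothing printed is asserted as a fact: (1.70) is a `def … : Prop`, derived from (1.49) under `hres`.
-/

open MeasureTheory

namespace Literature.MathematicalPhysics.QuantumFieldTheory.Balaban1983to89.B16Eq170Assembly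

open B16Sect1Wilson B16Sect1Assembly

noncomputable section

variable {ΩV ΩN ΩNB : Type*} [MeasurableSpace ΩV] [MeasurableSpace ΩN] [MeasurableSpace ΩNB]

/-- The BRACKET of the exponential under the `B`-integral of (1.70) p. 377: `−½⟨DH″_{1,k,Z}B, ζDH″_{1,k,Z}B⟩ −
A((1/(g″_k(·))²)ζ₁, U″_{h+2}(exp ig_kB, V″)) + Σ_Y V(Y, U_k, B) + E_k(Z) + (−½d(𝐠) log g_k⁻² + log σ₀)|𝐁₀∖T₀| − E_k(Λ)`, every
term a function of the integration variable `B` or a constant (`Q121`, `Ah2` as in `B16Sect1Assembly.bracket149`; `SV b` =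
`Σ_Y V(Y, U_k, B)`; `EkZ` = `E_k(Z)`, p. 378 *"the sum of normalization terms and vacuum energy terms with localizations
intersecting the large field domain Z"*; `nBT = |𝐁₀∖T₀|`; `EkΛ = E_k(Λ)` of (1.10)). [cite: Balaban1989LargeFieldII, (1.70) p.377] -/
def bracket170 (gk dg σ₀ : ℝ) (nBT : ℕ) (EkZ EkΛ : ℝ) (Q121 Ah2 SV : ΩNB → ℝ) : ΩNB → ℝ :=
  fun b => -(1 / 2) * Q121 b - Ah2 b + SV b + EkZ + Ek110 dg gk σ₀ nBT - EkΛ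

/-- The RIGHT-HAND SIDE of (1.70) p. 377 as a real number: `pref` = `χ_kχ_{k,Λ}δ_{G₀}(V′_k)χ`, `Apk` = the value
`A′_k(1/(g_k(·))², U_k)` of the new action (p. 377: *"Denote this action by A′_k"*), `χh = χ_{h,1/2}`, the `B`-integral of
`σ(g_kB)χ′ exp[bracket170]` against `μNB = dB δ_{T₀}(B)` (`wN b = σ(g_kB)χ′`). [cite: Balaban1989LargeFieldII, (1.70) p.377] -/
def rhs170 (pref χh Apk : ℝ) (μNB : Measure ΩNB) (wN bracket : ΩNB → ℝ) : ℝ :=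
  pref * Real.exp Apk * (χh * ∫ b, wN b * Real.exp (bracket b) ∂μNB)

/-- **(1.70)** p. 377 [PDF 23], verbatim: *"The result of all the preceding operations can be written as the equality:
(1.1) = χ_kχ_{k,Λ}δ_{G₀}(V′_k)χ exp A′_k(1/(g_k(·))², U_k) · χ_{h,1/2}∫dB σ(g_kB)δ_{T₀}(B)χ′ exp[−½⟨DH″_{1,k,Z}B, ζDH″_{1,k,Z}B⟩
− A((1/(g″_k(·))²)ζ₁, U″_{h+2}(exp ig_kB, V″)) + Σ_Y V(Y, U_k, B) + E_k(Z) + (−½d(𝐠) log g_k⁻² + log σ₀)|𝐁₀∖T₀| − E_k(Λ)],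
(1.70)"* — as a `Prop`: the expression (1.1) (`B16Sect1Assembly.term11`, with its data `pref, χh, gk, A1, μV, AV, μN,
App`) EQUALS `rhs170`.  Not asserted (derived from (1.49) under the regrouping hypothesis in `eq170_of_eq149`).
[cite: Balaban1989LargeFieldII, (1.70) p.377] -/
def Eq170 (pref χh gk A1 : ℝ) (μV : Measure ΩV) (AV : ΩV → ℝ) (μN : Measure ΩN) (App : ΩN → ℝ) (Apk dg σ₀ : ℝ)
    (nBT : ℕ) (EkZ EkΛ : ℝ) (μNB : Measure ΩNB) (wN Q121 Ah2 SV : ΩNB → ℝ) : Prop :=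
  term11 pref χh gk A1 μV AV μN App = rhs170 pref χh Apk μNB wN (bracket170 gk dg σ₀ nBT EkZ EkΛ Q121 Ah2 SV)

omit [MeasurableSpace ΩNB] in
/-- The pointwise exponent identity behind (1.49) ↦ (1.70): under the regrouping `hres` (see `eq170_of_eq149`),
`−A(1/(g_k(·))², U_k) + bracket149 = A′_k + bracket170`. PROVED. [cite: Balaban1989LargeFieldII, (1.70) p.377] -/
theorem exponent149_eq_exponent170 {gk dg σ₀ Ekc EkΛ AcUk Apk EkZ : ℝ} {nBT : ℕ}
    {Q121 Ah2 Ck Ek Rk Bk Bppk SV : ΩNB → ℝ}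
    (hres : ∀ b, Ck b + Ek b + Rk b + Bk b + Bppk b - Ekc = (Apk + AcUk) + SV b + EkZ) (b : ΩNB) :
    -AcUk + bracket149 gk dg σ₀ nBT Ekc EkΛ Q121 Ah2 Ck Ek Rk Bk Bppk b =
      Apk + bracket170 gk dg σ₀ nBT EkZ EkΛ Q121 Ah2 SV b := by
  simp only [bracket149, bracket170]
  linear_combination hres b

/-- **(1.49) ↦ (1.70), PROVED**: if, pointwise in the integration variable `B`, the inductive terms of the (1.49) bracket
regroup as pp. 370–377 describe — `𝐂_k + 𝐄_k(U″_k) + 𝐑_k(U″_k) + 𝐁_k(U″_k, A) + 𝐁″_k(U″_k, A) − E_k = [A′_k(1/(g_k(·))², U_k) +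
A(1/(g_k(·))², U_k)] + Σ_Y V(Y, U_k, B) + E_k(Z)` (`hres`: the new action `A′_k = −A(1/(g_k(·))², U_k) +` the terms not
meeting `Z`, a `B`-INDEPENDENT number; `Σ_Y V(Y, U_k, B)` = `𝐂_k +` the `Z`-meeting parts and localization remainders;
`E_k(Z)` = the normalization/vacuum-energy terms meeting `Z`) — then the right-hand side of (1.49) equals the right-hand
side of (1.70): `exp[−A(1/(g_k(·))², U_k)]` times the integral of `exp[bracket149]` is `exp A′_k` times the integral of
`exp[bracket170]`. [cite: Balaban1989LargeFieldII, (1.70) p.377] -/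
theorem rhs149_eq_rhs170 {pref χh gk dg σ₀ Ekc EkΛ AcUk Apk EkZ : ℝ} {nBT : ℕ} {μNB : Measure ΩNB}
    {wN Q121 Ah2 Ck Ek Rk Bk Bppk SV : ΩNB → ℝ}
    (hres : ∀ b, Ck b + Ek b + Rk b + Bk b + Bppk b - Ekc = (Apk + AcUk) + SV b + EkZ) :
    rhs149 pref χh AcUk μNB wN (bracket149 gk dg σ₀ nBT Ekc EkΛ Q121 Ah2 Ck Ek Rk Bk Bppk) =
      rhs170 pref χh Apk μNB wN (bracket170 gk dg σ₀ nBT EkZ EkΛ Q121 Ah2 SV) := by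
  unfold rhs149 rhs170
  -- move the constant exponentials inside the integrals and compare integrands pointwise
  have h149 : Real.exp (-AcUk) *
        (χh * ∫ b, wN b * Real.exp (bracket149 gk dg σ₀ nBT Ekc EkΛ Q121 Ah2 Ck Ek Rk Bk Bppk b) ∂μNB) =
      χh * ∫ b, Real.exp (-AcUk) *
        (wN b * Real.exp (bracket149 gk dg σ₀ nBT Ekc EkΛ Q121 Ah2 Ck Ek Rk Bk Bppk b)) ∂μNB := by
    rw [integral_const_mul]; ring
  have h170 : Real.exp Apk * (χh * ∫ b, wN b * Real.exp (bracket170 gk dg σ₀ nBT EkZ EkΛ Q121 Ah2 SV b) ∂μNB) =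
      χh * ∫ b, Real.exp Apk * (wN b * Real.exp (bracket170 gk dg σ₀ nBT EkZ EkΛ Q121 Ah2 SV b)) ∂μNB := by
    rw [integral_const_mul]; ring
  have hint : (fun b => Real.exp (-AcUk) *
        (wN b * Real.exp (bracket149 gk dg σ₀ nBT Ekc EkΛ Q121 Ah2 Ck Ek Rk Bk Bppk b))) =
      fun b => Real.exp Apk * (wN b * Real.exp (bracket170 gk dg σ₀ nBT EkZ EkΛ Q121 Ah2 SV b)) := by
    funext b
    have h := congrArg Real.exp (exponent149_eq_exponent170 (gk := gk) (dg := dg) (σ₀ := σ₀) (EkΛ := EkΛ)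
      (nBT := nBT) (Q121 := Q121) (Ah2 := Ah2) hres b)
    rw [Real.exp_add, Real.exp_add] at h
    calc _ = wN b * (Real.exp (-AcUk) *
          Real.exp (bracket149 gk dg σ₀ nBT Ekc EkΛ Q121 Ah2 Ck Ek Rk Bk Bppk b)) := by ring
      _ = wN b * (Real.exp Apk * Real.exp (bracket170 gk dg σ₀ nBT EkZ EkΛ Q121 Ah2 SV b)) := by rw [h]
      _ = _ := by ring
  rw [mul_assoc pref, mul_assoc pref, h149, h170, hint]

/-- **(1.70) from (1.49)**: with the gen-4 derivation of (1.49) (`B16Sect1Assembly.eq149`, hypotheses `hpos`, `hcov`,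
`hApp`, `h3748` — positivity of the denominator, the chart in the numerator, the form of `A″_k`, (1.37)∘(1.48) pointwise)
and the regrouping `hres` of pp. 370–377, the expression (1.1) equals the right-hand side of (1.70) — `Eq170` with
`Σ_Y V(Y, U_k, B)` containing `𝐂_k = I(U₀) + small` (`B16Sect1Assembly.Ck149`). PROVED. [cite: Balaban1989LargeFieldII, (1.70) p.377] -/
theorem eq170_of_eq149 {pref χh gk A1 A00 AcUk Apk dg σ₀ Ekc EkZ : ℝ} {nBT nΛ : ℕ} {μV : Measure ΩV}
    {AV : ΩV → ℝ} {μN : Measure ΩN} {App : ΩN → ℝ} {μNB : Measure ΩNB}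
    {wN AppB AppW Q121 Ah2 Ek Rk Bk Bppk small SV : ΩNB → ℝ} (hpos : 0 < den11 gk μV AV)
    (hcov : num11 μN App = Real.exp (Ek110 dg gk σ₀ nBT) * ∫ b, wN b * Real.exp (AppB b) ∂μNB)
    (hApp : ∀ b, AppB b = -AppW b + Ek b + Rk b + Bk b + Bppk b - Ekc)
    (h3748 : ∀ b, -(1 / gk ^ 2) * A1 - AppW b + 1 / gk ^ 2 * A00 = -AcUk - 1 / 2 * Q121 b - Ah2 b + small b)
    (hres : ∀ b, Ck149 (I110 gk A00 (Ek110 dg gk σ₀ nΛ) (den11 gk μV AV)) small b + Ek b + Rk b + Bk b + Bppk b -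
      Ekc = (Apk + AcUk) + SV b + EkZ) :
    Eq170 pref χh gk A1 μV AV μN App Apk dg σ₀ nBT EkZ (Ek110 dg gk σ₀ nΛ) μNB wN Q121 Ah2 SV := by
  unfold Eq170
  rw [eq149 hpos hcov hApp h3748, rhs149_eq_rhs170 hres]

/-- (1.70) read as the input of the next step (p. 378: *"we will transform further the integral expression in (1.70)"* —
the 𝐓′_k(X)-operation (1.71) is built from this `B`-integral localized in a component): under `Eq170` the number (1.1)
factorizes as `[prefactor · exp A′_k] × [χ_{h,1/2} · (the B-integral)]`. Bookkeeping. [cite: Balaban1989LargeFieldII, (1.70) p.377] -/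
theorem eq170_factorizes {pref χh gk A1 Apk dg σ₀ EkZ EkΛ : ℝ} {nBT : ℕ} {μV : Measure ΩV} {AV : ΩV → ℝ}
    {μN : Measure ΩN} {App : ΩN → ℝ} {μNB : Measure ΩNB} {wN Q121 Ah2 SV : ΩNB → ℝ}
    (h : Eq170 pref χh gk A1 μV AV μN App Apk dg σ₀ nBT EkZ EkΛ μNB wN Q121 Ah2 SV) :
    term11 pref χh gk A1 μV AV μN App =
      (pref * Real.exp Apk) *
        (χh * ∫ b, wN b * Real.exp (bracket170 gk dg σ₀ nBT EkZ EkΛ Q121 Ah2 SV b) ∂μNB) := by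
  rw [h, rhs170]

end

end Literature.MathematicalPhysics.QuantumFieldTheory.Balaban1983to89.B16Eq170Assembly
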